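import Mathlib
import Summits.Ventures.HodgeRepro.PeriodCloserC7Model
import Summits.Ventures.HodgeRepro.PeriodCloserC7IdentificationChain
import Summits.Ventures.HodgeRepro.PeriodCloserC7Spectral
import Summits.Ventures.HodgeRepro.PeriodCloserC7CupProduct

/-!
# PeriodCloserC7IdentificationModel — the components of the identification are satisfiable

Blind re-derivation cell `pub-hodge-repro`, seat night-2 (gen 2).  Target tree path
`lean/Summits/Ventures/HodgeRepro/PeriodCloserC7IdentificationModel.lean`.

`PeriodCloserC7Identification.lean` refines the ONE unprinted hypothesis `Identification I` of the chain into the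
components (D0)–(D4) and (S1)–(S3) over two small interfaces `DoublingInterface I`, `SpectralInterface I`, and
`PeriodCloserC7IdentificationChain.lean` runs the chain from them;
`PeriodCloserC7Doubling.lean` / `PeriodCloserC7Spectral.lean` / `PeriodCloserC7CupProduct.lean` derive (D3), (S1),
(S2), (D2) from kernel-level data.  This
file instantiates everything on the toy face `toyFace L` of `PeriodCloserC7Model.lean` (every number `1`, every
automorphic predicate `True`, every quotient a point) and checks every component and every kernel-level
hypothesis, so that the refined hypothesis set `ChainHypothesesRefined` of `S4face_of_components` and the
kernel-level sets `KernelComponents` / `SpectralExpansion` / `LineComponents` are not self-contradictory, jointly on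
one kernel interface (`componentsSatisfiable`, `toy_kernelComponents`, `toy_spectralExpansion`, `toy_lineComponents`,
`toy_doubling_of_kernel`) — the same non-vacuity check `PeriodCloserC7Model.lean` makes for
`ChainHypotheses`.  A toy instantiation says nothing about
the intended one; nothing here says anything about the status of the Hodge conjecture for CM abelian varieties,
which is NOT proved.
-/

set_option autoImplicit false

noncomputable section

namespace Summit.Ventures.HodgeRepro.PeriodCloser

open NumberField

variable (L : Type) [Field L] [NumberField L] [IsCMField L]

/-- **The toy doubling interface**: forms are complex numbers; a `(1,0)`-form `a` has the coefficient pair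
`(a, 1)` and a `2`-form `c` the coefficient `c`, so the wedge is `a − b` (`= wedgeCoeff (a, 1) (b, 1)`); the Hodge
pairing is `a · \overline{b}`; the line `j` lifts to the number `j`, each plane lift is `−1` (`= 0 − 1 = 2 − 3`), so
the Hodge pairing of the two plane lifts is `1`; the torus quotient is a point, the period functional is
evaluation, the theta integral and the Siegel–Eisenstein series are the constant `1`. -/
def toyDoubling : DoublingInterface (toyFace L) where
  Form := ℂ
  hodge := fun a b => a * starRingEnd ℂ b
  wedge := fun a b => a - b
  cornerForm := fun _ j => (j.val : ℂ)
  lineLift := fun _ j => (j.val : ℂ)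
  planeLift := fun _ _ => -1
  TorusPt := Unit
  period := fun _ F => F ()
  thetaIntegral := fun _ _ => 1
  eisenstein := fun _ _ => 1

/-- The toy satisfies (D0)–(D4) and the definitional match. -/
theorem toy_doublingComponents : DoublingComponents (toyFace L) (toyDoubling L) where
  corner := fun _ _ => rfl
  forms := fun _ => by
    simp only [toyDoubling, line, map_sub, map_natCast]
    norm_num
  cup := fun _ i => by
    simp only [toyDoubling, line]
    fin_cases i <;> norm_num
  doubling := fun _ => by simp [toyDoubling]
  siegelWeil := fun _ _ => rfl
  torusDef := fun _ => rfl

/-- **The toy spectral interface**: one `τ` (the point), every `τ`-term `1`. -/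
def toySpectral : SpectralInterface (toyFace L) where
  spectrum := fun _ => {()}
  tauPairing := fun _ _ => 1

/-- The toy satisfies (S1)–(S3). -/
theorem toy_seesawComponents : SeesawComponents (toyFace L) (toySpectral L) where
  decomp := fun _ => by simp [toySpectral]
  factors := fun _ _ _ => ⟨fun _ => trivial, trivial⟩
  isolate := fun d τ _ _ => ⟨d, by simp [toySpectral], one_ne_zero⟩

/-- The toy also satisfies the finer (S3a) and (S3b) separately. -/
theorem toy_hecke_rallis : HeckeIsolation (toyFace L) (toySpectral L) ∧ RallisNonvanishing (toyFace L) (toySpectral L) :=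
  ⟨fun d τ _ => ⟨d, by simp [toySpectral], fun _ => trivial⟩,
    fun d τ _ _ _ => ⟨d, by simp [toySpectral], one_ne_zero⟩⟩

/-- The identification of the toy, recovered from its components (agrees with `toy_identification`). -/
theorem toy_identification_of_components : Identification (toyFace L) :=
  identification_of_components (toyFace L) (toyDoubling L) (toySpectral L) (toy_doublingComponents L)
    (toy_seesawComponents L)

/-- **The refined chain hypotheses are satisfiable**: the toy face with its toy interfaces satisfies
`ChainHypothesesRefined`. -/
def toy_chainHypothesesRefined : ChainHypothesesRefined (toyFace L) where
  D := toyDoubling L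
  hD := toy_doublingComponents L
  S := toySpectral L
  hS := toy_seesawComponents L
  lemmaPi := (toy_chainHypotheses L).lemmaPi
  witness := (toy_chainHypotheses L).witness
  tp1 := (toy_chainHypotheses L).tp1
  bhty := (toy_chainHypotheses L).bhty
  bhtySplit := (toy_chainHypotheses L).bhtySplit
  xi := (toy_chainHypotheses L).xi
  productFormula := (toy_chainHypotheses L).productFormula
  flipAdm := FlipRootNumberAdm.of_univ (toyFace L) (toy_chainHypotheses L).flip (toy_chainHypotheses L).family
  discharge := (toy_chainHypotheses L).discharge
  family := (toy_chainHypotheses L).family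

/-- **Non-vacuity of the refined chain**: for every CM field `L` there is an instantiation of the face interface
with component interfaces satisfying `ChainHypothesesRefined` — the hypothesis set of `S4face_of_components` is
not self-contradictory. -/
theorem componentsSatisfiable : ∃ I : C7Face L, Nonempty (ChainHypothesesRefined I) :=
  ⟨toyFace L, ⟨toy_chainHypothesesRefined L⟩⟩

/-- The refined chain theorem applied to the toy returns its (trivial) conclusion. -/
theorem toy_S4face_of_components : (toyFace L).S4face :=
  S4face_of_components (toyFace L) (toy_chainHypothesesRefined L)

/-- **The toy kernel interface**: every quotient a point, every integral evaluation at the point, the `2`-form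
coefficient the number itself, every character `1`, each plane kernel `−1` (the plane lift) and the doubled kernel
`1` (`= (−1) · \overline{(−1)}`). -/
def toyKernel : KernelInterface (toyFace L) (toyDoubling L) where
  XPt := Unit
  TPt := fun _ => Unit
  torusEquiv := (Equiv.punitProd Unit).symm
  intX := fun F => F ()
  intT := fun _ F => F ()
  coeff := fun a _ => a
  char := fun _ _ _ => 1
  kernel := fun _ _ _ _ => -1
  kernelDoubled := fun _ _ _ => 1

/-- The toy satisfies the kernel components of the doubling identity. -/
theorem toy_kernelComponents : KernelComponents (toyFace L) (toyDoubling L) (toyKernel L) where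
  hodge_def := fun _ _ => rfl
  planeLift_def := fun _ _ _ => by simp [toyKernel, toyDoubling]
  period_def := fun _ _ => by simp [toyKernel, toyDoubling]
  thetaIntegral_def := fun _ _ => rfl
  poisson := fun _ _ _ _ => by simp [toyKernel]
  intX_smul := fun _ _ => rfl
  intT_smul := fun _ _ _ => rfl
  intT_conj := fun _ _ => rfl
  fubini := fun _ _ => rfl

/-- (D3) of the toy, recovered from its kernel components. -/
theorem toy_doublingIdentity_of_kernel : DoublingIdentity (toyFace L) (toyDoubling L) :=
  (toy_kernelComponents L).doublingIdentity

/-- **The toy spectral kernel**: one basis vector, one `τ`, every vector `1` and every lift `−1` (the plane kernel). -/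
def toySpectralKernel : SpectralKernel (toyFace L) (toyDoubling L) (toyKernel L) where
  Idx := Unit
  basis := fun _ => {()}
  spectrum := fun _ => {()}
  vec := fun _ _ _ => 1
  lift := fun _ _ _ _ => -1

/-- The toy satisfies the spectral expansion hypotheses. -/
theorem toy_spectralExpansion : (toySpectralKernel L).SpectralExpansion (toy_kernelComponents L) where
  expansion := fun _ _ _ _ => by simp [toySpectralKernel, toyKernel]
  orth := fun _ τ τ' h => absurd (Subsingleton.elim τ τ') h
  intT_sum := fun _ _ _ => rfl
  intT_sumTau := fun _ _ _ => rfl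
  intX_sum := fun _ _ => rfl
  intX_sumTau := fun _ _ => rfl
  toric_link := fun _ _ _ => by
    simp only [SpectralKernel.toric, toySpectralKernel, toyKernel, toyFace, mul_one, ne_eq, one_ne_zero,
      not_false_eq_true, and_true, true_iff]
    exact ⟨(), Finset.mem_singleton_self ()⟩
  lift_link := fun _ _ _ => trivial

/-- **The toy line interface** over the toy kernel: every line quotient a point, the line integral evaluation,
the coefficient pair of a `(1,0)`-form `a` is `(a, 1)`, every character `1`, the line kernel of the line `j` is
`(j, 1)`. -/
def toyLine : LineInterface (toyFace L) (toyDoubling L) (toyKernel L) where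
  LPt := fun _ => Unit
  lineEquiv := fun _ => (Equiv.punitProd Unit).symm
  intL := fun _ F => F ()
  coeff1 := fun a _ => (a, 1)
  lchar := fun _ _ _ => 1
  lkernel := fun _ j _ _ => ((j.val : ℂ), 1)

/-- The toy satisfies the line components on the SAME kernel interface as `toy_kernelComponents` (Bergeron's
identity reads `−1 = wedgeCoeff (2i, 1) (2i+1, 1) = 2i − (2i+1)`). -/
theorem toy_lineComponents : LineComponents (toyFace L) (toyDoubling L) (toyKernel L) (toyLine L) where
  lineLift_def := fun _ _ _ => by simp [toyLine, toyDoubling]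
  wedge_def := fun _ _ _ => by simp [toyLine, toyKernel, toyDoubling, wedgeCoeff]
  char_prod := fun _ _ _ => by simp [toyLine, toyKernel]
  bergeron := fun _ i _ _ => by
    simp only [toyLine, toyKernel, wedgeCoeff, line]
    fin_cases i <;> norm_num
  intT_prod := fun _ _ => rfl
  intL_smul := fun _ _ _ => rfl
  intL_sub := fun _ _ _ => rfl

/-- The doubling form of the toy, recovered from its kernel-level inputs alone (`doubling_of_kernel`). -/
theorem toy_doubling_of_kernel : ∀ d : (toyFace L).Datum, (toyFace L).hodgePairing d = (toyFace L).torusPeriod d :=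
  (toy_lineComponents L).doubling_of_kernel (toy_kernelComponents L) (toy_doublingComponents L).corner
    (toy_doublingComponents L).forms (toy_doublingComponents L).siegelWeil (toy_doublingComponents L).torusDef

/-- (S1) and (S2) of the toy, recovered from its spectral expansion. -/
theorem toy_spectral_of_kernel :
    SpectralDecomposition (toyFace L) (toySpectralKernel L).toSpectral ∧
      TermFactors (toyFace L) (toySpectralKernel L).toSpectral :=
  ⟨SpectralKernel.spectralDecomposition (toy_spectralExpansion L) (toy_doublingComponents L).corner
    (toy_doublingComponents L).forms (toy_doublingComponents L).cup,
    SpectralKernel.termFactors (toy_spectralExpansion L)⟩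

end Summit.Ventures.HodgeRepro.PeriodCloser

end
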